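/-
# Lattice sampling of Suzuki's screw function under «the supremum of the real parts is attained»
— part B1 (§3: the coefficient bound and the main theorem) — CARVE of part B for the ≤ 400-line tree norm

(rh-split cell, seat rh-split-screw-bridge g12, 2026-08-27; kernel scratch for card
`cards/SPLIT-screw-bridge.md` §17; carved by rh-split-typer-2 g5, lead RULING #138.)  Nothing in this file is a claim
about the truth of RH.
-/
import Summits.RiemannHypothesis.RiemannHypothesis.Theorems.Splittings.ScrewLatticeSupA
import Summits.RiemannHypothesis.RiemannHypothesis.Theorems.Splittings.ScrewLatticeFozC
import Literature.NumberTheory.LFunctions.RHWave0HardyProofs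
import HarnessLib

/-!
# Part B — lattice sampling of the screw function when `sup |Re ρ - 1/2|` is attained

Let `Ψ = zetaScrew` be Suzuki's screw function of `ζ`, `Ψ(t) = Σ_ρ m(ρ) Re[(cosh(κt) - 1)/κ²]`
(`κ = ρ - 1/2`, unconditional zero series `Suzuki2023_thm11_series_holds`), sampled along a lattice
`t = k h`, `k ∈ ℕ`, `h > 0` fixed.

**Main theorem** (`strip_of_supAttained_of_latticeFloor`).  Let `h > 0`, `η ≥ 0`, `B ∈ ℝ` with
`|Re ρ - 1/2| ≤ B` for every non-trivial zero, and suppose that either `B ≤ η` or the bound `B` is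
**attained** by some zero.  If `Ψ(k h) ≥ -K e^{η k h}` for all `k ∈ ℕ`, then every non-trivial zero
satisfies `|Re ρ - 1/2| ≤ η`.

This removes the finiteness hypothesis of g11's `ScrewLatticeFoz.strip_of_cofiniteStrip_of_latticeFloor`
(finitely many zeros beyond `B'`): the top layer `|Re ρ - 1/2| = B` may now be **infinite** and the
zeros below it may **accumulate at `B`** (no spectral gap).  The only residual hypothesis is that the
supremum is a maximum — exactly the hypothesis of Ingham's theorem `ψ(x) - x = Ω_±(x^Θ)` («if there is
a zero with real part `Θ`», Ingham 1932, Thm 33/Ch. V).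

**The splitting** (`maxRe_and_latticePos_iff_rh`, every `h > 0`):

  `RiemannHypothesis ↔ (∃ ρ₀ ∈ 𝒩, ∀ ρ ∈ 𝒩, Re ρ ≤ Re ρ₀) ∧ (∀ k ∈ ℕ, 0 ≤ Ψ(k h))`,

`𝒩` = the non-trivial zeros: **«Θ = sup Re ρ is attained» ∧ «Ψ ≥ 0 on one arithmetic progression»
⟺ RH.**  `A = MaxRe` is RH-implied (Hardy: a zero on the line exists) and not known to imply RH;
`B =` lattice positivity is RH-implied (Suzuki Thm 1.7) and not known to imply RH; `A ∧ B ⇒ RH` is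
this file.  Since `CofiniteCriticalLine ⇒ MaxRe` (`supAttainedOrLe_of_cofiniteStrip`), g11's splitting
`CofiniteCriticalLine ∧ LAT(h) ⟺ RH` is a corollary.

**Mechanism.**  With `B` attained and `η < B`, put `g_ρ(k) = 2 e^{-Bkh} Re[m (cosh κkh - 1)/κ²]`,
`c_ρ = [|σ| = B]·m/κ²`, `u_ρ = e^{iλ_ρ h}` (`λ_ρ = sgn(σ) γ`).  Termwise `g_ρ(k) - Re(c_ρ u_ρ^k) → 0`
(top layer: `re_term_top`; below: `e^{(|σ|-B)kh} → 0`, each zero at its own rate), under the summable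
majorant `4 m/γ²`; `Re c_ρ < 0` on the top layer (`|γ| > 14 > |σ|`).  The lattice floor gives
`Σ'_ρ g_ρ(k) = 2 e^{-Bkh} Ψ(kh) ≥ -2K e^{(η-B)kh} → 0`, contradicting the Tannery form of the
Bohr-mean lemma (`ScrewLatticeSup.false_of_tsum_trig_eventually_ge`, part A).

## CARVE NOTE (rh-split-typer-2 g5, lead RULING #138 (c), 2026-08-27)

PART B1 = §3 (`norm_coeff_le`, `strip_of_supAttained_of_latticeFloor`) of the frozen object
`HOME/rh-split-screw-bridge/g12/ScrewLatticeSupB.lean` (sha16 9b7abcaf67226fb2, 462 lines; author seat rh-split-screw-bridge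
g12), cut at the seat-named declaration boundary before the section header «## 4.» (source l.257; g12/README-g12.md) because tree files are
≤ 400 lines: source lines 62–256 are reproduced BYTE-IDENTICALLY below, the module docstring above is the source's verbatim,
imports and preamble are the source's; PART B2 (`Splittings/ScrewLatticeSupB2.lean`, §§4–6: graded dictionary, the splitting
`RH ⟺ MaxRe ∧ LAT(h)`, `§16 ⊂ §17`, placement of the A-conjunct) imports this file and re-opens the namespace
`…Theorems.Splittings.ScrewLatticeSup`, so every fully-qualified name is unchanged.  No statement, proof or docstring byte of
any declaration was changed.  Nothing here bears on the truth of RH.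
-/

set_option linter.dupNamespace false

noncomputable section

open Complex Filter Topology Finset
open scoped ComplexConjugate

namespace Summit.RiemannHypothesis.RiemannHypothesis.Theorems.Splittings.ScrewLatticeSup

open Literature.NumberTheory.LFunctions
open ZetaZeros.riemannZetaNontrivialZeros
open Summit.RiemannHypothesis.RiemannHypothesis.Theorems.Splittings.ScrewLatticeFoz

/-! ## 3. The coefficient bound and the main theorem -/

/-- `‖m(ρ)/(ρ - 1/2)²‖ ≤ 2 m(ρ)/Im(ρ)²` (`‖κ²‖ = ‖κ‖² ≥ γ²`). -/
theorem norm_coeff_le (ρ : ZetaZeros.riemannZetaNontrivialZeros) :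
    ‖(riemannZetaZeroOrder (ρ : ℂ) : ℂ) / ((ρ : ℂ) - 1 / 2) ^ 2‖ ≤
      2 * (riemannZetaZeroOrder (ρ : ℂ) : ℝ) / (ρ : ℂ).im ^ 2 := by
  have hm := FordL33.order_pos ρ
  have hγ : (ρ : ℂ).im ≠ 0 := im_ne_zero ρ.2
  have hγ2 : 0 < (ρ : ℂ).im ^ 2 := by positivity
  have hden : (ρ : ℂ).im ^ 2 ≤ ‖((ρ : ℂ) - 1 / 2) ^ 2‖ := by
    rw [norm_pow]
    have him : (((ρ : ℂ) - 1 / 2).im) = (ρ : ℂ).im := by simp [sub_im]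
    have h := Complex.abs_im_le_norm ((ρ : ℂ) - 1 / 2)
    rw [him] at h
    have h' : |(ρ : ℂ).im| ^ 2 ≤ ‖(ρ : ℂ) - 1 / 2‖ ^ 2 := pow_le_pow_left₀ (abs_nonneg _) h 2
    rwa [sq_abs] at h'
  rw [norm_div, Complex.norm_intCast, abs_of_pos hm]
  calc (riemannZetaZeroOrder (ρ : ℂ) : ℝ) / ‖((ρ : ℂ) - 1 / 2) ^ 2‖
      ≤ (riemannZetaZeroOrder (ρ : ℂ) : ℝ) / (ρ : ℂ).im ^ 2 :=
        div_le_div_of_nonneg_left hm.le hγ2 hden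
    _ ≤ 2 * (riemannZetaZeroOrder (ρ : ℂ) : ℝ) / (ρ : ℂ).im ^ 2 := by
        rw [mul_div_assoc]
        have h0 : 0 ≤ (riemannZetaZeroOrder (ρ : ℂ) : ℝ) / (ρ : ℂ).im ^ 2 := by positivity
        linarith

/-- **Lattice sampling when the supremum is attained.**  Let `h > 0`, `η ≥ 0`, `B ∈ ℝ` with
`|Re ρ - 1/2| ≤ B` for all non-trivial zeros and (`B ≤ η` or `|Re ρ₀ - 1/2| = B` for some zero
`ρ₀`).  If `Ψ(k h) ≥ -K e^{η k h}` for all `k ∈ ℕ`, then `|Re ρ - 1/2| ≤ η` for every non-trivial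
zero.  No finiteness and no gap below the top layer is assumed. -/
theorem strip_of_supAttained_of_latticeFloor {h η B : ℝ} (hh : 0 < h) (hη : 0 ≤ η)
    (hB : ∀ ρ : ℂ, ρ ∈ ZetaZeros.riemannZetaNontrivialZeros → |ρ.re - 1 / 2| ≤ B)
    (hatt : B ≤ η ∨ ∃ ρ₀ : ℂ, ρ₀ ∈ ZetaZeros.riemannZetaNontrivialZeros ∧ |ρ₀.re - 1 / 2| = B)
    (hfloor : ∃ K : ℝ, ∀ k : ℕ, -K * Real.exp (η * (k * h)) ≤ zetaScrew (k * h)) :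
    ∀ ρ : ℂ, ρ ∈ ZetaZeros.riemannZetaNontrivialZeros → |ρ.re - 1 / 2| ≤ η := by
  classical
  rcases le_or_gt B η with hBη | hηB
  · exact fun ρ hρ ↦ (hB ρ hρ).trans hBη
  exfalso
  obtain ⟨ρ₀, hρ₀, hρ₀B⟩ := hatt.resolve_left (not_le.2 hηB)
  obtain ⟨K, hK⟩ := hfloor
  have hBpos : 0 < B := lt_of_le_of_lt hη hηB
  set i₀ : ZetaZeros.riemannZetaNontrivialZeros := ⟨ρ₀, hρ₀⟩ with hi₀
  have hi₀B : |(i₀ : ℂ).re - 1 / 2| = B := hρ₀B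
  -- the terms of the zero series, as functions of real `t`
  set f : ZetaZeros.riemannZetaNontrivialZeros → ℝ → ℂ := fun ρ t ↦
    (riemannZetaZeroOrder (ρ : ℂ) : ℂ) *
      ((Complex.cosh (((ρ : ℂ) - 1 / 2) * t) - 1) / ((ρ : ℂ) - 1 / 2) ^ 2) with hf
  -- data for the Bohr-mean lemma
  set b : ZetaZeros.riemannZetaNontrivialZeros → ℝ := fun ρ ↦
    2 * (2 * (riemannZetaZeroOrder (ρ : ℂ) : ℝ) / (ρ : ℂ).im ^ 2) with hb
  set g : ZetaZeros.riemannZetaNontrivialZeros → ℕ → ℝ := fun ρ k ↦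
    2 * Real.exp (-(B * (k * h))) * (f ρ (k * h)).re with hg
  set c' : ZetaZeros.riemannZetaNontrivialZeros → ℂ := fun ρ ↦
    (riemannZetaZeroOrder (ρ : ℂ) : ℂ) / ((ρ : ℂ) - 1 / 2) ^ 2 with hc'
  set c : ZetaZeros.riemannZetaNontrivialZeros → ℂ := fun ρ ↦
    if |(ρ : ℂ).re - 1 / 2| = B then c' ρ else 0 with hc
  set lam : ZetaZeros.riemannZetaNontrivialZeros → ℝ :=
    fun ρ ↦ if 1 / 2 ≤ (ρ : ℂ).re then (ρ : ℂ).im else -(ρ : ℂ).im with hlam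
  set u : ZetaZeros.riemannZetaNontrivialZeros → ℂ :=
    fun ρ ↦ Complex.exp (((lam ρ * h : ℝ) : ℂ) * I) with hu
  have hbs : Summable b := ZetaScrewGrowth.summable_two_mul_order_div_im_sq.mul_left 2
  have hb0 : ∀ ρ : ZetaZeros.riemannZetaNontrivialZeros,
      0 ≤ 2 * (riemannZetaZeroOrder (ρ : ℂ) : ℝ) / (ρ : ℂ).im ^ 2 := fun ρ ↦ by
    have := FordL33.order_pos ρ
    positivity
  -- `e^{Bt} e^{-Bt} = 1`
  have hxy : ∀ k : ℕ, Real.exp (B * (k * h)) * Real.exp (-(B * (k * h))) = 1 := fun k ↦ by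
    rw [← Real.exp_add, add_neg_cancel, Real.exp_zero]
  -- the majorant
  have hgb : ∀ ρ k, |g ρ k| ≤ b ρ := by
    intro ρ k
    have ht : 0 ≤ (k : ℝ) * h := by positivity
    have h1 := norm_term_le ρ ht
    have h2 : Real.exp (|(ρ : ℂ).re - 1 / 2| * (k * h)) ≤ Real.exp (B * (k * h)) :=
      Real.exp_le_exp.2 (mul_le_mul_of_nonneg_right (hB ρ ρ.2) ht)
    have h3 : |(f ρ (k * h)).re| ≤ ‖f ρ (k * h)‖ := Complex.abs_re_le_norm _
    have hy : 0 < Real.exp (-(B * (k * h))) := Real.exp_pos _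
    have h4 : |(f ρ (k * h)).re| ≤ Real.exp (B * (k * h)) *
        (2 * (riemannZetaZeroOrder (ρ : ℂ) : ℝ) / (ρ : ℂ).im ^ 2) :=
      h3.trans (h1.trans (mul_le_mul_of_nonneg_right h2 (hb0 ρ)))
    simp only [hg]
    rw [abs_mul, abs_mul, abs_two, abs_of_pos hy]
    calc 2 * Real.exp (-(B * (k * h))) * |(f ρ (k * h)).re|
        ≤ 2 * Real.exp (-(B * (k * h))) * (Real.exp (B * (k * h)) *
          (2 * (riemannZetaZeroOrder (ρ : ℂ) : ℝ) / (ρ : ℂ).im ^ 2)) := by gcongr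
      _ = b ρ := by
          simp only [hb]
          rw [show 2 * Real.exp (-(B * (k * h))) * (Real.exp (B * (k * h)) *
              (2 * (riemannZetaZeroOrder (ρ : ℂ) : ℝ) / (ρ : ℂ).im ^ 2)) =
              2 * (Real.exp (B * (k * h)) * Real.exp (-(B * (k * h)))) *
              (2 * (riemannZetaZeroOrder (ρ : ℂ) : ℝ) / (ρ : ℂ).im ^ 2) by ring, hxy k, mul_one]
  have hun : ∀ ρ, ‖u ρ‖ = 1 := fun ρ ↦ by
    simp only [hu]
    exact Complex.norm_exp_ofReal_mul_I _
  have hcre : ∀ ρ, (c ρ).re ≤ 0 := fun ρ ↦ by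
    simp only [hc]
    split_ifs
    · exact (re_coeff_neg ρ).le
    · simp
  have hcb : ∀ ρ, ‖c ρ‖ ≤ b ρ := fun ρ ↦ by
    have h1 := norm_coeff_le ρ
    have h0 := hb0 ρ
    simp only [hc, hb]
    split_ifs
    · simp only [hc'] at h1 ⊢
      linarith
    · rw [norm_zero]
      positivity
  -- termwise convergence `g_ρ(k) - Re(c_ρ u_ρ^k) → 0`
  have hupow : ∀ (ρ : ZetaZeros.riemannZetaNontrivialZeros) (k : ℕ),
      Complex.exp (((lam ρ * ((k : ℝ) * h) : ℝ) : ℂ) * I) = u ρ ^ k := fun ρ k ↦ by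
    simp only [hu]
    rw [← Complex.exp_nat_mul]
    congr 1
    push_cast
    ring
  have hlim : ∀ ρ, Tendsto (fun k : ℕ ↦ g ρ k - (c ρ * u ρ ^ k).re) atTop (𝓝 0) := by
    intro ρ
    by_cases htop : |(ρ : ℂ).re - 1 / 2| = B
    · -- top layer
      have hcρ : c ρ = c' ρ := by simp only [hc]; rw [if_pos htop]
      refine squeeze_zero_norm (a := fun k : ℕ ↦ 4 * ‖c' ρ‖ * Real.exp (-B * (k * h)))
        (fun k ↦ ?_) ?_
      · have ht : 0 ≤ (k : ℝ) * h := by positivity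
        have hy : 0 < Real.exp (-(B * (k * h))) := Real.exp_pos _
        have h' := re_term_top ρ ht
        rw [htop, hupow ρ k] at h'
        have hid : g ρ k - (c ρ * u ρ ^ k).re = 2 * Real.exp (-(B * (k * h))) *
            ((f ρ (k * h)).re - Real.exp (B * (k * h)) / 2 * (c' ρ * u ρ ^ k).re) := by
          rw [hcρ]
          simp only [hg]
          rw [mul_sub, show 2 * Real.exp (-(B * (k * h))) *
              (Real.exp (B * (k * h)) / 2 * (c' ρ * u ρ ^ k).re) =
              (Real.exp (B * (k * h)) * Real.exp (-(B * (k * h)))) * (c' ρ * u ρ ^ k).re by ring,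
            hxy k, one_mul]
        rw [Real.norm_eq_abs, hid, abs_mul, abs_mul, abs_two, abs_of_pos hy]
        calc 2 * Real.exp (-(B * (k * h))) *
              |(f ρ (k * h)).re - Real.exp (B * (k * h)) / 2 * (c' ρ * u ρ ^ k).re|
            ≤ 2 * Real.exp (-(B * (k * h))) * (2 * ‖c' ρ‖) := by gcongr
          _ = 4 * ‖c' ρ‖ * Real.exp (-B * (k * h)) := by rw [neg_mul]; ring
      · have := (tendsto_exp_lattice (neg_neg_of_pos hBpos) hh).const_mul (4 * ‖c' ρ‖)
        simpa using this
    · -- below the top layer: `c_ρ = 0` and the term decays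
      have hcρ : c ρ = 0 := by simp only [hc]; rw [if_neg htop]
      have hlt : |(ρ : ℂ).re - 1 / 2| < B := lt_of_le_of_ne (hB ρ ρ.2) htop
      refine squeeze_zero_norm (a := fun k : ℕ ↦
        2 * (2 * (riemannZetaZeroOrder (ρ : ℂ) : ℝ) / (ρ : ℂ).im ^ 2) *
          (Real.exp (-(B * (k * h))) * Real.exp (|(ρ : ℂ).re - 1 / 2| * (k * h))))
        (fun k ↦ ?_) ?_
      · have ht : 0 ≤ (k : ℝ) * h := by positivity
        have hy : 0 < Real.exp (-(B * (k * h))) := Real.exp_pos _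
        have h3 : |(f ρ (k * h)).re| ≤ ‖f ρ (k * h)‖ := Complex.abs_re_le_norm _
        rw [hcρ, zero_mul, Complex.zero_re, sub_zero, Real.norm_eq_abs]
        simp only [hg]
        rw [abs_mul, abs_mul, abs_two, abs_of_pos hy]
        calc 2 * Real.exp (-(B * (k * h))) * |(f ρ (k * h)).re|
            ≤ 2 * Real.exp (-(B * (k * h))) * (Real.exp (|(ρ : ℂ).re - 1 / 2| * (k * h)) *
              (2 * (riemannZetaZeroOrder (ρ : ℂ) : ℝ) / (ρ : ℂ).im ^ 2)) := by
              gcongr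
              exact h3.trans (norm_term_le ρ ht)
          _ = 2 * (2 * (riemannZetaZeroOrder (ρ : ℂ) : ℝ) / (ρ : ℂ).im ^ 2) *
              (Real.exp (-(B * (k * h))) * Real.exp (|(ρ : ℂ).re - 1 / 2| * (k * h))) := by
              ring
      · have := (tendsto_exp_neg_mul_exp_lattice hlt hh).const_mul
          (2 * (2 * (riemannZetaZeroOrder (ρ : ℂ) : ℝ) / (ρ : ℂ).im ^ 2))
        simpa using this
  -- the attained top zero has `Re c < 0`
  have h0 : (c i₀).re < 0 := by
    simp only [hc]
    rw [if_pos hi₀B]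
    exact re_coeff_neg i₀
  refine false_of_tsum_trig_eventually_ge hbs hgb hun hcre hcb hlim h0 ?_
  -- the floor: `Σ'_ρ g_ρ(k) = 2 e^{-Bkh} Ψ(kh) ≥ -2K e^{-Bkh} e^{ηkh} → 0`
  have hEt : Tendsto (fun k : ℕ ↦
      2 * K * (Real.exp (-(B * (k * h))) * Real.exp (η * (k * h)))) atTop (𝓝 0) := by
    simpa using (tendsto_exp_neg_mul_exp_lattice hηB hh).const_mul (2 * K)
  intro ε hε
  obtain ⟨N₁, hN₁⟩ := eventually_atTop.1 (hEt.eventually (gt_mem_nhds hε))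
  refine ⟨N₁, fun k hk ↦ ?_⟩
  have hsum : HasSum (fun ρ ↦ f ρ (k * h)) (zetaScrew (k * h) : ℂ) :=
    Suzuki2023_thm11_series_holds ((k : ℝ) * h)
  have hre : HasSum (fun ρ ↦ (f ρ (k * h)).re) (zetaScrew (k * h)) := by
    have := Complex.hasSum_re hsum
    rwa [Complex.ofReal_re] at this
  have hgsum : HasSum (fun ρ ↦ g ρ k) (2 * Real.exp (-(B * (k * h))) * zetaScrew (k * h)) :=
    hre.mul_left _
  rw [hgsum.tsum_eq]
  have hy : 0 < Real.exp (-(B * (k * h))) := Real.exp_pos _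
  have h2 : 2 * Real.exp (-(B * (k * h))) * (-K * Real.exp (η * (k * h))) ≤
      2 * Real.exp (-(B * (k * h))) * zetaScrew (k * h) :=
    mul_le_mul_of_nonneg_left (hK k) (by positivity)
  have h3 : 2 * Real.exp (-(B * (k * h))) * (-K * Real.exp (η * (k * h))) =
      -(2 * K * (Real.exp (-(B * (k * h))) * Real.exp (η * (k * h)))) := by ring
  linarith [hN₁ k hk]


end Summit.RiemannHypothesis.RiemannHypothesis.Theorems.Splittings.ScrewLatticeSup
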